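import Summits.QuantumFields.YangMills.Theorems.BalabanUVNodesN05SubBP2DK2PerKappaSlotExistsOfThm33JunctionHGuarded
import Literature.MathematicalPhysics.QuantumFieldTheory.Balaban1983to89.B8Prop6Reg335ZdDomainSeq

/-!
# EDITION «K2» (director-ym №227 (b′-2), plan YMPLAN-G87-N05-GO (R2); dag-n05-d g14, 2026-08-28): this module RE-KEYED onto PRINT's (1.3)–(1.4) CLASS AT THE PINNED BLOCK SIZE on
# the HYPOTHESIS side — the junction binders range over `j : Node00.IdxB8SubDκ θ Mκ Rκ` (print-class members ONLY; N06's `Sep22Zd` currency, dag-n05-w1 `IdxB8SubDκ.sep22Zd`), [4]'s letters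
# and the b9 sockets are supplied ∕ demanded at print-class members only (`Admissible134 θ.L Mκ Rκ i.k i.Ω` as ONE extra member hypothesis), the root is the «K2» κ-periodic root
# `…K2PerKappaSlotExistsGuarded.exists_residB8_b8LeafOfRecordSubBP₂DPerκ_cutSubBP₅κ_of_lettersSrc_γ'_guarded` (Proposition 5 pinned on print's class), `(Mκ Rκ : ℕ)` bound up front,
# the period `Pκ` trailing; proofs VERBATIM (generator `gen_junction_k2.py` on the tree bytes of the κ-periodic editions p647160 ∕ p647574 ∕ p647867).  The rest of this header is
# the κ-periodic edition's VERBATIM.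
# BalabanUVNodes ∕ N05 ([Balaban1985RegularSpaces] Lemma 1 p. 79 – Thm 8 p. 101, Prop. 6 p. 99, (1.3)–(1.5) p. 77, p. 77 «Ω_j ⊂ T_η»): P4 — THE J-N06→N05 JUNCTION ON THE
# (β′-PERIODIC) κ-CUT ROAD, PART 2 of 3: PROPOSITION 6's BINDER DISCHARGED (dag-n05-e's editions, re-run)

Track A of `YM-PLAN.md` (cell `pub-ymgap`, HUMAN RULING D-0062), node **N05**; seat `pub-ymgap-dag-n05-d` (g14, P4 pen), 2026-08-28; bears on K1⁹ `stmt-QuantumFields-27364`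
(`--supports … --as helper`, count-neutral).  CREDIT: the Proposition-6 discharge is dag-n05-e's (p629759 ∕ p632654); the «P₂D» guarded twins are this seat's p639920.

WHAT.  `BalabanUVNodesN05SubBP2DK2PerKappaSlotExistsOfThm33JunctionHWithQQPP6Guarded` (p639920) RE-RUN, token for token by `gen_junction_per.py` on the tree bytes, on part 1's
κ-periodic `…_withQQP_guarded`: hypotheses VERBATIM; the inner conclusion gains `∀ (Pκ Mκ Rκ : ℕ),` and reads the κ-cut periodic δ₂-slot
`∃ lam c₁ ρ₀ ax, 0 < c₁ ∧ 1 ≤ ρ₀ ∧ B8LeafOfRecordSubBP₂DPerκ θ Pκ Mκ Rκ ⟨lam.cutSubBP₅κPer Pκ Mκ Rκ c₁ ρ₀, ax⟩`; proofs VERBATIM with `Pκ Mκ Rκ` passed through.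
* §3 ★★★ `…_withQQP_P6_guarded` — EIGHT binders (no `hP6`, no `havg`), `bg := bgZd`, `ιCfg := ιCfgZd` ⊢ the κ-periodic row under Prop. 6's constants `c35₀, M₆`.
* §4 ★★★ `…_withQQP_P6I_guarded` — the index-generic edition (`π : I → MemberZd`, `hmem`) ⊢ the same.
HONEST FRAMING: as part 1 — composition BY NAME; 0 estimates; binders = N06 content at the ℤᵈ-keyed members; p7 slot junk-inhabited (census); count-neutral; **N05 NOT
discharged**; K1⁹ NOT claimed; FLAG №10 NOT closed; Bałaban AS PRINTED; one finite 𝕋⁴ programme at fixed ε; nothing continuum ∕ ℝ⁴ ∕ OS ∕ mass-gap ∕ Clay.  No `sorry`,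
no new definition.  Unit `pub-ymgap-dag-n05-d` (g14).
[cite: Balaban1985RegularSpaces, Prop. 6 (1.134)–(1.138) p.99, (1.33) p.82, (1.3)–(1.5) p.77, p.77 («Ω_j ⊂ T_η»), Lemma 1 – Thm 8 pp.79–101; Balaban1985BackgroundPropagators, (3.16) p.393, (3.35) p.396, Thm 3.1 p.397, Thm 3.3 p.399]
-/

noncomputable section

namespace Summit.QuantumFields.YangMills.BalabanUVNodes.N05SubBP2DK2PerKappaSlotExistsOfThm33JunctionHWithQQPP6Guarded

open Literature.MathematicalPhysics.QuantumFieldTheory.Balaban1983to89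
open Literature.MathematicalPhysics.QuantumFieldTheory.Balaban1983to89.Node00
open Literature.MathematicalPhysics.QuantumFieldTheory.Balaban1983to89.B8Eq134Admissible (Admissible134)
open Literature.MathematicalPhysics.QuantumFieldTheory.Balaban1983to89.B8IdxB8LawsB (IdxB8LawsB)
open Literature.MathematicalPhysics.QuantumFieldTheory.Balaban1983to89.B8LeafModelZd (ZdIdx)
open Literature.MathematicalPhysics.QuantumFieldTheory.Balaban1983to89.B8TowerBondsPrinted (towerBondsP)
open Literature.MathematicalPhysics.QuantumFieldTheory.Balaban1983to89.B8SockLettersRD (SockLettersRD)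
open Literature.MathematicalPhysics.QuantumFieldTheory.Balaban1983to89.B8Eq138LandauZd (covLap QT)
open B7Prop1Explicit B7Prop2Explicit B7Prop1Local
open B8Ineq132 (InAk covDerivFwd)
open B7Eq78Linearization (zdBlocking QprimeIter)
open B8Eq119TwistedAxial (bgT)
open B8Eq140Level (SideTouches)
open B8Eq1117Concrete (XSpace)
open B8Prop5ContractionKLevel (Bd2)
open B8LambdaSpaceKLevel (wt)
open B9SupplySockB9P3ZdLetters (OpsZd)
open B9SupplySockB9P3ZdAt (DictAt Prop6At LandauAt SrcAt)
open B9SupplySockB9P3ZdAtLin (LinBddAt)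
open B9SupplySockB9P3ZdGammaInAk (CurvAtInAk)
open B9SupplySockB9P3ZdGammaUnivDelta2 (HolderAtδ2)
open B9SupplySockB9P3ZdAtHerm (InvAtH)
open B9SupplySockB9P3ZdGammaUnivDelta2Src (SrcHolderAtδ2)
open B9SupplySockB9P3ZdFrame (MemberZd memZd bgZd ιCfgZd reg335_bgZd_iff)
open B9Eq316AveragingTransposeZdPrinted (withQQP)
open B8Prop6Reg335ZdAllTorus (prop6At_bgZd_mono)
open B8Prop6Reg335ZdDomainSeq (prop6At_binder_domainSeq_holds)
open Summit.QuantumFields.YangMills.BalabanUVNodes.N05SubBP2DK2PerKappaSlotExistsOfThm33JunctionHGuarded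
  (exists_residB8_b8LeafOfRecordSubBP₂DPerκ_cutSubBP₅κ_of_letters_thm33_junctionH_withQQP_guarded)
-- `Site` alone could resolve to the torus sites of `Setup.lean`; re-export the `ℤ^d` sites of `B7Prop1Explicit`.

export B7Prop1Explicit (Site)

section WithQQPP6Guarded

/-- ★★★ **(β′-PERIODIC κ-CUT ROAD; director-ym №222 A-5′) GUARDED EDITION** (the witness CARRIES `0 < c₁ ∧ 1 ≤ ρ₀` — director-ym №217 (2)(i), ref-D VERDICT-415) of
★★★ **THE J-N06→N05 JUNCTION APPLIED ON THE «P₂D» ROAD AT THE `ℤᵈ` FRAME OF RECORD, PROPOSITION 6's BINDER DISCHARGED** — for `θ` with `2 ≤ θ.D`, `5 ≤ θ.L`: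
Proposition 6 produces `c35₀, M₆ > 0` such that for every leaf constant `c35 ≥ c35₀` and every junction floor `M₃ ≥ M₆`, [4]'s letters `SLet ∕ SLetUB`, any half-frame
`(geo, Gp, GA, ιLoc, ops)` over `MemberZd θ.D θ.L` with the backgrounds of record `bgZd θ.𝔸 θ.L`, N06's `B9.Thm33Printed c35 geo (bgZd θ.𝔸 θ.L) Gp GA`, the genuine
averaging letter pin `hops`, and the EIGHT junction binders `DictAt ∕ InvAtH ∕ CurvAtInAk ∕ LandauAt ∕ HolderAtδ2 ∕ LinBddAt ∕ SrcAt ∕ SrcHolderAtδ2` at every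
`j : Node00.IdxB8SubDκ θ Mκ Rκ` give the N05 row `∃ lam c₁ ρ₀ ax, 0 < c₁ ∧ 1 ≤ ρ₀ ∧ B8LeafOfRecordSubBP₂DPerκ θ Pκ Mκ Rκ ⟨lam.cutSubBP₅κPer Pκ Mκ Rκ c₁ ρ₀, ax⟩` (every period `Pκ`, every pinned pair `(Mκ, Rκ)`; dag-n05-w1's κ-cut periodic δ₂-slot).  Proof: the companion theorem with `(I, mem, bg, ιCfg) :=
(MemberZd, memZd, bgZd, ιCfgZd)` and `hP6 := prop6At_binder_domainSeq_holds` (every `IdxB8SubD` member obeys (1.3)–(1.4), `IdxB8SubD.domainSeq`; odd `L` is `θ.hL.1`),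
moved to the leaf's `c35` by `prop6At_bgZd_mono`.  Hypotheses are N06 content; N05 NOT discharged.
[cite: Balaban1985RegularSpaces, Prop. 6 (1.134)–(1.138) p.99, (1.33) p.82, (1.3)–(1.5) p.77, Lemma 1 – Thm 8 pp.79–101; Balaban1985BackgroundPropagators, (3.35) p.396, Thm 3.1 p.397, Thm 3.3 p.399] -/
theorem exists_residB8_b8LeafOfRecordSubBP₂DPerκ_cutSubBP₅κ_of_letters_thm33_junctionH_withQQP_P6_guarded (θ : Stage3Params) (hD : 2 ≤ θ.D) (hL5 : 5 ≤ θ.L) (Mκ Rκ : ℕ)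
    [FiniteDimensional ℝ θ.𝔸] :
    ∃ c35₀ M₆ : ℝ, 0 < c35₀ ∧ 0 < M₆ ∧
      ∀ ⦃c35 : ℝ⦄, c35₀ ≤ c35 → ∀ ⦃M₃ : ℝ⦄, M₆ ≤ M₃ →
      -- [Balaban1985BackgroundPropagators] Thm 3.1's letter bounds and threshold
      ∀ {B₀'H B₂' BG BR cL : ℝ}, 0 < B₀'H → 0 ≤ B₂' → 0 ≤ BG → 0 ≤ BR → 0 < cL →
      -- [4]'s letters AT THE (1.3)–(1.5)-ADMISSIBLE `Ω₀ = ℤᵈ` LAW MEMBERS (p619291's texts verbatim): existence side and uniqueness side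
      (∀ i : ZdIdx θ.D θ.L, i.Ω 0 = Set.univ → IdxB8LawsB θ.L i → B8ConstraintBonds.DomainSeq θ.L i.Ω → (∀ l, l < i.k → ∀ z ∈ i.Λs i.k l, ((θ.L : ℤ) ^ l) • z ∈ B8ConstraintBonds.Lam θ.L i.Ω l) → Admissible134 θ.L Mκ Rκ i.k i.Ω → SockLettersRD (𝔸 := θ.𝔸) θ.L BG BR B₀'H B₂' cL i.η i.k i.Ω i.Λs) →
      (∀ i : ZdIdx θ.D θ.L, i.Ω 0 = Set.univ → IdxB8LawsB θ.L i → B8ConstraintBonds.DomainSeq θ.L i.Ω → (∀ l, l < i.k → ∀ z ∈ i.Λs i.k l, ((θ.L : ℤ) ^ l) • z ∈ B8ConstraintBonds.Lam θ.L i.Ω l) → Admissible134 θ.L Mκ Rκ i.k i.Ω → ∀ α₀ : ℝ, 0 < α₀ → α₀ ≤ cL → ∀ U₀ : Site θ.D → Fin θ.D → θ.𝔸ˣ, (∀ x κ, U₀ x κ ∈ unitaryUnits θ.𝔸) →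
        InAk θ.L i.k i.η α₀ i.Ω U₀ →
        ∃ (g Δ : (Site θ.D → θ.𝔸) →ₗ[ℂ] (Site θ.D → θ.𝔸)) (q : (Site θ.D → θ.𝔸) →ₗ[ℂ] (ℕ → Site θ.D → θ.𝔸))
          (qs : (ℕ → Site θ.D → θ.𝔸) →ₗ[ℂ] (Site θ.D → θ.𝔸)) (Aw c : (ℕ → Site θ.D → θ.𝔸) →ₗ[ℂ] (ℕ → Site θ.D → θ.𝔸))
          (H' : XSpace θ.D i.k θ.𝔸 →ₗ[ℂ] (Site θ.D → θ.𝔸)),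
          (∀ x : Site θ.D → θ.𝔸, (∃ C : ℝ, ∀ y, ‖x y‖ ≤ C) → g (Δ x + qs (Aw (q x))) = x) ∧ (∀ φ, qs (c (q (g (g (qs φ))))) = qs φ) ∧
          (∀ (f : Site θ.D → θ.𝔸), ∀ x ∈ i.Ω 0, Δ f x = covLap i.η U₀ ((i.Ω 0).indicator f) x) ∧
          (∀ (μ : ℕ → Site θ.D → θ.𝔸), ∀ x ∈ i.Ω 0, qs μ x = QT θ.L i.k (i.Λs i.k) U₀ μ x) ∧
          (∀ (f : Site θ.D → θ.𝔸) (n : ℕ), n ≤ i.k → ∀ y ∈ i.Λs i.k n, q f n y = QprimeIter (zdBlocking θ.D θ.L) (bgT θ.L U₀) n f y) ∧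
          (∀ (f : Site θ.D → θ.𝔸) (n : ℕ) (y : Site θ.D), ¬ (n ≤ i.k ∧ y ∈ i.Λs i.k n) → q f n y = 0) ∧
          (∀ (X : XSpace θ.D i.k θ.𝔸) (x : Site θ.D), ‖H' X x‖ ≤ B₀'H * ‖X‖) ∧
          (∀ n, n ≤ i.k → ∀ (X : XSpace θ.D i.k θ.𝔸), ∀ p ∈ {b : Site θ.D × Fin θ.D | SideTouches (i.Ω n) b.1 b.2},
            wt θ.L i.η n * ‖covDerivFwd i.η U₀ p.2 (H' X) p.1‖ ≤ B₀'H * ‖X‖) ∧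
          (∀ X : XSpace θ.D i.k θ.𝔸, Bd2 θ.L i.η i.k i.Ω (covLap i.η U₀ (H' X)) (B₂' * ‖X‖)) ∧
          (∀ (Y : XSpace θ.D i.k θ.𝔸) (n : ℕ) (hn : n ≤ i.k) (y : Site θ.D), y ∈ i.Λs i.k n →
            QprimeIter (zdBlocking θ.D θ.L) (bgT θ.L U₀) n (H' Y) y = Y (⟨n, Nat.lt_succ_of_le hn⟩, y)) ∧
          (∀ (f : Site θ.D → θ.𝔸) (r : ℝ), 0 ≤ r → Bd2 θ.L i.η i.k i.Ω f r →
            (∀ x, ‖g f x‖ ≤ BG * r) ∧ ∀ n, n ≤ i.k → ∀ p ∈ {b : Site θ.D × Fin θ.D | SideTouches (i.Ω n) b.1 b.2},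
              wt θ.L i.η n * ‖covDerivFwd i.η U₀ p.2 (g f) p.1‖ ≤ BG * r) ∧
          (∀ (f : Site θ.D → θ.𝔸) (r : ℝ), 0 ≤ r → Bd2 θ.L i.η i.k i.Ω f r → Bd2 θ.L i.η i.k i.Ω (f - g (qs (c (q (g f))))) (BR * r))) →
      -- N06's HALF-FRAME over the `ℤᵈ` members of record (geometries, the two kernel families of Thms 3.1–3.3 at the backgrounds `bgZd`, the locality map, the letters)
      ∀ (geo : MemberZd θ.D θ.L → B9.Geometry) (Gp GA : ∀ x, B9.KernelFamily (geo x) (bgZd θ.𝔸 θ.L x))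
        (ιLoc : ∀ (M : ℝ) (i : ZdIdx θ.D θ.L) (m : ℕ), (Site θ.D → Fin θ.D → θ.𝔸) → (geo (memZd M i m)).Loc)
        (ops : ℝ → ZdIdx θ.D θ.L → ℕ → OpsZd θ.D θ.𝔸)
      -- THE GENUINE AVERAGING LETTER (as in the companion; `θ.𝔸` finite-dimensional over `ℝ`, a theorem-level instance)
        (τ : θ.𝔸 →ₗ[ℂ] ℂ) {Cτ : ℝ}, (∀ x y : θ.𝔸, |(τ (star x * y)).re| ≤ Cτ * ‖x‖ * ‖y‖) →
      ∀ (ops₀ : ℝ → ZdIdx θ.D θ.L → ℕ → OpsZd θ.D θ.𝔸),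
        (∀ (M : ℝ) (i : ZdIdx θ.D θ.L) (m : ℕ), ops M i m = withQQP τ θ.L (fun m' l => towerBondsP θ.L i.Ω (i.Λs m') l) ops₀ M i m) →
      ∀ {a₃ c69 β cS cSβ : ℝ} {CH : ℝ → ℝ} {len : Site θ.D → ℝ},
      -- N06's THEOREM 3.3 AS PRINTED at the backgrounds of record, by name
        B9.Thm33Printed c35 geo (bgZd θ.𝔸 θ.L) Gp GA →
      -- dag-n06-b's JUNCTION DICTIONARY BINDERS at the (1.3)–(1.5)-admissible members, guarded — EIGHT of them: NO `havg` (companion), NO `hP6` (this file)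
        (∀ (M : ℝ) (j : IdxB8SubDκ θ Mκ Rκ) (m : ℕ), 1 ≤ M → M₃ ≤ M → m ≤ j.1.1.1.1.1.k → DictAt geo (bgZd θ.𝔸 θ.L) GA θ.L memZd (ιCfgZd θ.𝔸 θ.L) ιLoc ops M j.1.1.1.1.1 m) →
        (∀ (M : ℝ) (j : IdxB8SubDκ θ Mκ Rκ) (m : ℕ), 1 ≤ M → M₃ ≤ M → m ≤ j.1.1.1.1.1.k → InvAtH (bgZd θ.𝔸 θ.L) θ.L memZd (ιCfgZd θ.𝔸 θ.L) ops c35 a₃ M j.1.1.1.1.1 m) →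
        (∀ (M : ℝ) (j : IdxB8SubDκ θ Mκ Rκ) (m : ℕ), 1 ≤ M → M₃ ≤ M → m ≤ j.1.1.1.1.1.k → CurvAtInAk θ.L ops c69 M j.1.1.1.1.1 m) →
        (∀ (M : ℝ) (j : IdxB8SubDκ θ Mκ Rκ) (m : ℕ), 1 ≤ M → M₃ ≤ M → m ≤ j.1.1.1.1.1.k → LandauAt (bgZd θ.𝔸 θ.L) θ.L memZd (ιCfgZd θ.𝔸 θ.L) ops c35 a₃ M j.1.1.1.1.1 m) →
        (∀ (M : ℝ) (j : IdxB8SubDκ θ Mκ Rκ) (m : ℕ), 1 ≤ M → M₃ ≤ M → m ≤ j.1.1.1.1.1.k → HolderAtδ2 geo (bgZd θ.𝔸 θ.L) GA θ.L memZd (ιCfgZd θ.𝔸 θ.L) ops β len CH M j.1.1.1.1.1 m) →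
        (∀ (M : ℝ) (j : IdxB8SubDκ θ Mκ Rκ) (m : ℕ), 1 ≤ M → M₃ ≤ M → m ≤ j.1.1.1.1.1.k → LinBddAt θ.L ops M j.1.1.1.1.1 m) →
        (∀ (M : ℝ) (j : IdxB8SubDκ θ Mκ Rκ) (m : ℕ), 1 ≤ M → M₃ ≤ M → m ≤ j.1.1.1.1.1.k → SrcAt (bgZd θ.𝔸 θ.L) θ.L memZd (ιCfgZd θ.𝔸 θ.L) ops c35 a₃ cS M j.1.1.1.1.1 m) →
        (∀ (M : ℝ) (j : IdxB8SubDκ θ Mκ Rκ) (m : ℕ), 1 ≤ M → M₃ ≤ M → m ≤ j.1.1.1.1.1.k → SrcHolderAtδ2 (bgZd θ.𝔸 θ.L) θ.L memZd (ιCfgZd θ.𝔸 θ.L) ops c35 a₃ β len cSβ M j.1.1.1.1.1 m) →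
      -- the junction's primitive constants ((3.27) `a₃`, (3.69) `c69`, source `c_S c_Sβ`) and Theorem 8's source size factor `γ₈`
        0 < a₃ → 0 ≤ c69 → 0 ≤ cS → 0 ≤ cSβ → ∀ {γ₈ : ℝ}, 1 ≤ γ₈ →
        ∀ (Pκ : ℕ), (∀ B₀' B₁ : ℝ, 0 < B₀' → 2 ≤ B₁ → 3 * (2 * (θ.D : ℝ) * (θ.L : ℝ) ^ 2) * BG * BR ≤ B₀' / 2 → B8.Prop5Exists B₀' B₁ (lanOfRecordSubCκPer θ Pκ Mκ Rκ B₁)) →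
        ∃ (lam : ResidB8 θ) (c₁ : ℝ) (ρ₀ : ℕ)
          (ax : ∀ j : IdxB8SubDPer θ Pκ, (famB8OfRecordPer θ (lam.cutSubBP₅κPer Pκ Mκ Rκ c₁ ρ₀).β (lam.cutSubBP₅κPer Pκ Mκ Rκ c₁ ρ₀).len Pκ j).Cfg →
            (famB8OfRecordPer θ (lam.cutSubBP₅κPer Pκ Mκ Rκ c₁ ρ₀).β (lam.cutSubBP₅κPer Pκ Mκ Rκ c₁ ρ₀).len Pκ j).Pert → (famB8OfRecordPer θ (lam.cutSubBP₅κPer Pκ Mκ Rκ c₁ ρ₀).β (lam.cutSubBP₅κPer Pκ Mκ Rκ c₁ ρ₀).len Pκ j).Pert),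
          0 < c₁ ∧ 1 ≤ ρ₀ ∧ B8LeafOfRecordSubBP₂DPerκ θ Pκ Mκ Rκ ⟨lam.cutSubBP₅κPer Pκ Mκ Rκ c₁ ρ₀, ax⟩ := by
  have hL1 : 1 ≤ θ.L := le_trans (by norm_num) hL5
  -- [B8] PROPOSITION 6 at the `ℤᵈ` frame of record, every (1.3)–(1.4) member (dag-n05-e p620522 §4; odd `L` from the datum)
  obtain ⟨c35₀, c₆, K₆, M₆, hc35₀, hc₆, hK₆, hM₆, hP6⟩ :=
    prop6At_binder_domainSeq_holds (𝔸 := θ.𝔸) hD hL5 θ.hL.1 (fun _ : ZdIdx θ.D θ.L => True)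
  refine ⟨c35₀, M₆, hc35₀, hM₆, ?_⟩
  intro c35 hc35 M₃ hM₃ B₀'H B₂' BG BR cL hB₀'H hB₂' hBG hBR hcL SLet SLetUB geo Gp GA ιLoc ops τ Cτ hCτ ops₀ hops a₃ c69 β cS cSβ CH len
    h33 hdict hinv hcurv hlan hhol hlin hsrc hsrcH ha₃ hc69 hcS hcSβ γ₈ hγ₈ Pκ p5ePer
  refine exists_residB8_b8LeafOfRecordSubBP₂DPerκ_cutSubBP₅κ_of_letters_thm33_junctionH_withQQP_guarded θ hD hL5 Mκ Rκ hB₀'H hB₂' hBG hBR hcL SLet SLetUB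
    geo (bgZd θ.𝔸 θ.L) Gp GA memZd (ιCfgZd θ.𝔸 θ.L) ιLoc ops τ hCτ ops₀ hops h33 hdict ?_ hinv hcurv hlan hhol hlin hsrc hsrcH hc₆ hK₆ ha₃ hc69 hcS hcSβ hγ₈ Pκ p5ePer
  -- `hP6` DISCHARGED: the member obeys (1.3)–(1.4) (`IdxB8SubD.domainSeq`), the floor `M₆ ≤ M₃ ≤ M`, and the class constant moved up to the leaf's `c35`
  intro M j m hM1 hM hm
  exact prop6At_bgZd_mono (𝔸 := θ.𝔸) hL1 hc35 (le_trans zero_le_one hM1) hK₆.le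
    (hP6 M j.1.1.1.1.1 m trivial j.1.domainSeq (le_trans hM₃ hM))

end WithQQPP6Guarded

section WithQQPP6IGuarded

/-- ★★★ **(β′-PERIODIC κ-CUT ROAD; director-ym №222 A-5′) GUARDED EDITION** (the witness CARRIES `0 < c₁ ∧ 1 ≤ ρ₀` — director-ym №217 (2)(i), ref-D VERDICT-415) of
★★★ **THE INDEX-GENERIC EDITION (v1.1): THE BACKGROUNDS OF RECORD THROUGH A RE-INDEXING MAP `π : I → MemberZd θ.D θ.L`, PROPOSITION 6's BINDER DISCHARGED** —
for `θ` with `2 ≤ θ.D`, `5 ≤ θ.L`: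
Proposition 6 produces `c35₀, M₆ > 0` such that for every leaf constant `c35 ≥ c35₀` and every junction floor `M₃ ≥ M₆`, [4]'s letters `SLet ∕ SLetUB`, any index `I` with a
re-indexing map `π : I → MemberZd θ.D θ.L`, member map `mem` with `π (mem M j m) = memZd M j m` at the admissible members, half-frame `(geo, Gp, GA, ιLoc, ops)` over `I`
with the backgrounds of record `fun i => bgZd θ.𝔸 θ.L (π i)` and `ιCfg := ιCfgZd`, N06's `B9.Thm33Printed c35 geo (fun i => bgZd θ.𝔸 θ.L (π i)) Gp GA` (over `I` —
sound sub-indices are the consumer's choice), the genuine averaging letter pin `hops`, and the EIGHT junction binders `DictAt ∕ InvAtH ∕ CurvAtInAk ∕ LandauAt ∕ HolderAtδ2 ∕ LinBddAt ∕ SrcAt ∕ SrcHolderAtδ2` at every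
`j : Node00.IdxB8SubDκ θ Mκ Rκ` give the N05 row `∃ lam c₁ ρ₀ ax, 0 < c₁ ∧ 1 ≤ ρ₀ ∧ B8LeafOfRecordSubBP₂DPerκ θ Pκ Mκ Rκ ⟨lam.cutSubBP₅κPer Pκ Mκ Rκ c₁ ρ₀, ax⟩` (every period `Pκ`, every pinned pair `(Mκ, Rκ)`; dag-n05-w1's κ-cut periodic δ₂-slot).  Proof: the companion theorem with `bg := fun i => bgZd θ.𝔸 θ.L (π i)`,
`ιCfg := ιCfgZd` and `hP6 := prop6At_binder_domainSeq_holds` (every `IdxB8SubD` member obeys (1.3)–(1.4), `IdxB8SubD.domainSeq`; odd `L` is `θ.hL.1`), moved to the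
leaf's `c35` by `prop6At_bgZd_mono` and transported along `hmem` through `reg335_bgZd_iff`.  Hypotheses are N06 content; N05 NOT discharged.
[cite: Balaban1985RegularSpaces, Prop. 6 (1.134)–(1.138) p.99, (1.33) p.82, (1.3)–(1.5) p.77, Lemma 1 – Thm 8 pp.79–101; Balaban1985BackgroundPropagators, (3.35) p.396, Thm 3.1 p.397, Thm 3.3 p.399] -/
theorem exists_residB8_b8LeafOfRecordSubBP₂DPerκ_cutSubBP₅κ_of_letters_thm33_junctionH_withQQP_P6I_guarded (θ : Stage3Params) (hD : 2 ≤ θ.D) (hL5 : 5 ≤ θ.L) (Mκ Rκ : ℕ)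
    [FiniteDimensional ℝ θ.𝔸] :
    ∃ c35₀ M₆ : ℝ, 0 < c35₀ ∧ 0 < M₆ ∧
      ∀ ⦃c35 : ℝ⦄, c35₀ ≤ c35 → ∀ ⦃M₃ : ℝ⦄, M₆ ≤ M₃ →
      -- [Balaban1985BackgroundPropagators] Thm 3.1's letter bounds and threshold
      ∀ {B₀'H B₂' BG BR cL : ℝ}, 0 < B₀'H → 0 ≤ B₂' → 0 ≤ BG → 0 ≤ BR → 0 < cL →
      -- [4]'s letters AT THE (1.3)–(1.5)-ADMISSIBLE `Ω₀ = ℤᵈ` LAW MEMBERS (p619291's texts verbatim): existence side and uniqueness side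
      (∀ i : ZdIdx θ.D θ.L, i.Ω 0 = Set.univ → IdxB8LawsB θ.L i → B8ConstraintBonds.DomainSeq θ.L i.Ω → (∀ l, l < i.k → ∀ z ∈ i.Λs i.k l, ((θ.L : ℤ) ^ l) • z ∈ B8ConstraintBonds.Lam θ.L i.Ω l) → Admissible134 θ.L Mκ Rκ i.k i.Ω → SockLettersRD (𝔸 := θ.𝔸) θ.L BG BR B₀'H B₂' cL i.η i.k i.Ω i.Λs) →
      (∀ i : ZdIdx θ.D θ.L, i.Ω 0 = Set.univ → IdxB8LawsB θ.L i → B8ConstraintBonds.DomainSeq θ.L i.Ω → (∀ l, l < i.k → ∀ z ∈ i.Λs i.k l, ((θ.L : ℤ) ^ l) • z ∈ B8ConstraintBonds.Lam θ.L i.Ω l) → Admissible134 θ.L Mκ Rκ i.k i.Ω → ∀ α₀ : ℝ, 0 < α₀ → α₀ ≤ cL → ∀ U₀ : Site θ.D → Fin θ.D → θ.𝔸ˣ, (∀ x κ, U₀ x κ ∈ unitaryUnits θ.𝔸) →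
        InAk θ.L i.k i.η α₀ i.Ω U₀ →
        ∃ (g Δ : (Site θ.D → θ.𝔸) →ₗ[ℂ] (Site θ.D → θ.𝔸)) (q : (Site θ.D → θ.𝔸) →ₗ[ℂ] (ℕ → Site θ.D → θ.𝔸))
          (qs : (ℕ → Site θ.D → θ.𝔸) →ₗ[ℂ] (Site θ.D → θ.𝔸)) (Aw c : (ℕ → Site θ.D → θ.𝔸) →ₗ[ℂ] (ℕ → Site θ.D → θ.𝔸))
          (H' : XSpace θ.D i.k θ.𝔸 →ₗ[ℂ] (Site θ.D → θ.𝔸)),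
          (∀ x : Site θ.D → θ.𝔸, (∃ C : ℝ, ∀ y, ‖x y‖ ≤ C) → g (Δ x + qs (Aw (q x))) = x) ∧ (∀ φ, qs (c (q (g (g (qs φ))))) = qs φ) ∧
          (∀ (f : Site θ.D → θ.𝔸), ∀ x ∈ i.Ω 0, Δ f x = covLap i.η U₀ ((i.Ω 0).indicator f) x) ∧
          (∀ (μ : ℕ → Site θ.D → θ.𝔸), ∀ x ∈ i.Ω 0, qs μ x = QT θ.L i.k (i.Λs i.k) U₀ μ x) ∧
          (∀ (f : Site θ.D → θ.𝔸) (n : ℕ), n ≤ i.k → ∀ y ∈ i.Λs i.k n, q f n y = QprimeIter (zdBlocking θ.D θ.L) (bgT θ.L U₀) n f y) ∧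
          (∀ (f : Site θ.D → θ.𝔸) (n : ℕ) (y : Site θ.D), ¬ (n ≤ i.k ∧ y ∈ i.Λs i.k n) → q f n y = 0) ∧
          (∀ (X : XSpace θ.D i.k θ.𝔸) (x : Site θ.D), ‖H' X x‖ ≤ B₀'H * ‖X‖) ∧
          (∀ n, n ≤ i.k → ∀ (X : XSpace θ.D i.k θ.𝔸), ∀ p ∈ {b : Site θ.D × Fin θ.D | SideTouches (i.Ω n) b.1 b.2},
            wt θ.L i.η n * ‖covDerivFwd i.η U₀ p.2 (H' X) p.1‖ ≤ B₀'H * ‖X‖) ∧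
          (∀ X : XSpace θ.D i.k θ.𝔸, Bd2 θ.L i.η i.k i.Ω (covLap i.η U₀ (H' X)) (B₂' * ‖X‖)) ∧
          (∀ (Y : XSpace θ.D i.k θ.𝔸) (n : ℕ) (hn : n ≤ i.k) (y : Site θ.D), y ∈ i.Λs i.k n →
            QprimeIter (zdBlocking θ.D θ.L) (bgT θ.L U₀) n (H' Y) y = Y (⟨n, Nat.lt_succ_of_le hn⟩, y)) ∧
          (∀ (f : Site θ.D → θ.𝔸) (r : ℝ), 0 ≤ r → Bd2 θ.L i.η i.k i.Ω f r →
            (∀ x, ‖g f x‖ ≤ BG * r) ∧ ∀ n, n ≤ i.k → ∀ p ∈ {b : Site θ.D × Fin θ.D | SideTouches (i.Ω n) b.1 b.2},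
              wt θ.L i.η n * ‖covDerivFwd i.η U₀ p.2 (g f) p.1‖ ≤ BG * r) ∧
          (∀ (f : Site θ.D → θ.𝔸) (r : ℝ), 0 ≤ r → Bd2 θ.L i.η i.k i.Ω f r → Bd2 θ.L i.η i.k i.Ω (f - g (qs (c (q (g f))))) (BR * r))) →
      -- ANY INDEX re-indexed into the `ℤᵈ` members of record by `π`, a member map landing on `memZd` at the admissible members, and N06's HALF-FRAME over it
      -- (geometries, the two kernel families of Thms 3.1–3.3 at the backgrounds `bgZd ∘ π`, the locality map, the letters)
      ∀ {I : Type} (π : I → MemberZd θ.D θ.L) (geo : I → B9.Geometry) (Gp GA : ∀ i, B9.KernelFamily (geo i) (bgZd θ.𝔸 θ.L (π i)))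
        (mem : ℝ → ZdIdx θ.D θ.L → ℕ → I),
        (∀ (M : ℝ) (j : IdxB8SubDκ θ Mκ Rκ) (m : ℕ), π (mem M j.1.1.1.1.1 m) = memZd M j.1.1.1.1.1 m) →
      ∀ (ιLoc : ∀ (M : ℝ) (i : ZdIdx θ.D θ.L) (m : ℕ), (Site θ.D → Fin θ.D → θ.𝔸) → (geo (mem M i m)).Loc)
        (ops : ℝ → ZdIdx θ.D θ.L → ℕ → OpsZd θ.D θ.𝔸)
      -- THE GENUINE AVERAGING LETTER (as in the companion; `θ.𝔸` finite-dimensional over `ℝ`, a theorem-level instance)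
        (τ : θ.𝔸 →ₗ[ℂ] ℂ) {Cτ : ℝ}, (∀ x y : θ.𝔸, |(τ (star x * y)).re| ≤ Cτ * ‖x‖ * ‖y‖) →
      ∀ (ops₀ : ℝ → ZdIdx θ.D θ.L → ℕ → OpsZd θ.D θ.𝔸),
        (∀ (M : ℝ) (i : ZdIdx θ.D θ.L) (m : ℕ), ops M i m = withQQP τ θ.L (fun m' l => towerBondsP θ.L i.Ω (i.Λs m') l) ops₀ M i m) →
      ∀ {a₃ c69 β cS cSβ : ℝ} {CH : ℝ → ℝ} {len : Site θ.D → ℝ},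
      -- N06's THEOREM 3.3 AS PRINTED at the backgrounds of record, by name
        B9.Thm33Printed c35 geo (fun i => bgZd θ.𝔸 θ.L (π i)) Gp GA →
      -- dag-n06-b's JUNCTION DICTIONARY BINDERS at the (1.3)–(1.5)-admissible members, guarded — EIGHT of them: NO `havg` (companion), NO `hP6` (this file)
        (∀ (M : ℝ) (j : IdxB8SubDκ θ Mκ Rκ) (m : ℕ), 1 ≤ M → M₃ ≤ M → m ≤ j.1.1.1.1.1.k → DictAt geo (fun i => bgZd θ.𝔸 θ.L (π i)) GA θ.L mem (fun M i m U₀ hU₀ => ιCfgZd θ.𝔸 θ.L M i m U₀ hU₀) ιLoc ops M j.1.1.1.1.1 m) →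
        (∀ (M : ℝ) (j : IdxB8SubDκ θ Mκ Rκ) (m : ℕ), 1 ≤ M → M₃ ≤ M → m ≤ j.1.1.1.1.1.k → InvAtH (fun i => bgZd θ.𝔸 θ.L (π i)) θ.L mem (fun M i m U₀ hU₀ => ιCfgZd θ.𝔸 θ.L M i m U₀ hU₀) ops c35 a₃ M j.1.1.1.1.1 m) →
        (∀ (M : ℝ) (j : IdxB8SubDκ θ Mκ Rκ) (m : ℕ), 1 ≤ M → M₃ ≤ M → m ≤ j.1.1.1.1.1.k → CurvAtInAk θ.L ops c69 M j.1.1.1.1.1 m) →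
        (∀ (M : ℝ) (j : IdxB8SubDκ θ Mκ Rκ) (m : ℕ), 1 ≤ M → M₃ ≤ M → m ≤ j.1.1.1.1.1.k → LandauAt (fun i => bgZd θ.𝔸 θ.L (π i)) θ.L mem (fun M i m U₀ hU₀ => ιCfgZd θ.𝔸 θ.L M i m U₀ hU₀) ops c35 a₃ M j.1.1.1.1.1 m) →
        (∀ (M : ℝ) (j : IdxB8SubDκ θ Mκ Rκ) (m : ℕ), 1 ≤ M → M₃ ≤ M → m ≤ j.1.1.1.1.1.k → HolderAtδ2 geo (fun i => bgZd θ.𝔸 θ.L (π i)) GA θ.L mem (fun M i m U₀ hU₀ => ιCfgZd θ.𝔸 θ.L M i m U₀ hU₀) ops β len CH M j.1.1.1.1.1 m) →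
        (∀ (M : ℝ) (j : IdxB8SubDκ θ Mκ Rκ) (m : ℕ), 1 ≤ M → M₃ ≤ M → m ≤ j.1.1.1.1.1.k → LinBddAt θ.L ops M j.1.1.1.1.1 m) →
        (∀ (M : ℝ) (j : IdxB8SubDκ θ Mκ Rκ) (m : ℕ), 1 ≤ M → M₃ ≤ M → m ≤ j.1.1.1.1.1.k → SrcAt (fun i => bgZd θ.𝔸 θ.L (π i)) θ.L mem (fun M i m U₀ hU₀ => ιCfgZd θ.𝔸 θ.L M i m U₀ hU₀) ops c35 a₃ cS M j.1.1.1.1.1 m) →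
        (∀ (M : ℝ) (j : IdxB8SubDκ θ Mκ Rκ) (m : ℕ), 1 ≤ M → M₃ ≤ M → m ≤ j.1.1.1.1.1.k → SrcHolderAtδ2 (fun i => bgZd θ.𝔸 θ.L (π i)) θ.L mem (fun M i m U₀ hU₀ => ιCfgZd θ.𝔸 θ.L M i m U₀ hU₀) ops c35 a₃ β len cSβ M j.1.1.1.1.1 m) →
      -- the junction's primitive constants ((3.27) `a₃`, (3.69) `c69`, source `c_S c_Sβ`) and Theorem 8's source size factor `γ₈`
        0 < a₃ → 0 ≤ c69 → 0 ≤ cS → 0 ≤ cSβ → ∀ {γ₈ : ℝ}, 1 ≤ γ₈ →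
        ∀ (Pκ : ℕ), (∀ B₀' B₁ : ℝ, 0 < B₀' → 2 ≤ B₁ → 3 * (2 * (θ.D : ℝ) * (θ.L : ℝ) ^ 2) * BG * BR ≤ B₀' / 2 → B8.Prop5Exists B₀' B₁ (lanOfRecordSubCκPer θ Pκ Mκ Rκ B₁)) →
        ∃ (lam : ResidB8 θ) (c₁ : ℝ) (ρ₀ : ℕ)
          (ax : ∀ j : IdxB8SubDPer θ Pκ, (famB8OfRecordPer θ (lam.cutSubBP₅κPer Pκ Mκ Rκ c₁ ρ₀).β (lam.cutSubBP₅κPer Pκ Mκ Rκ c₁ ρ₀).len Pκ j).Cfg →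
            (famB8OfRecordPer θ (lam.cutSubBP₅κPer Pκ Mκ Rκ c₁ ρ₀).β (lam.cutSubBP₅κPer Pκ Mκ Rκ c₁ ρ₀).len Pκ j).Pert → (famB8OfRecordPer θ (lam.cutSubBP₅κPer Pκ Mκ Rκ c₁ ρ₀).β (lam.cutSubBP₅κPer Pκ Mκ Rκ c₁ ρ₀).len Pκ j).Pert),
          0 < c₁ ∧ 1 ≤ ρ₀ ∧ B8LeafOfRecordSubBP₂DPerκ θ Pκ Mκ Rκ ⟨lam.cutSubBP₅κPer Pκ Mκ Rκ c₁ ρ₀, ax⟩ := by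
  have hL1 : 1 ≤ θ.L := le_trans (by norm_num) hL5
  -- [B8] PROPOSITION 6 at the `ℤᵈ` frame of record, every (1.3)–(1.4) member (dag-n05-e p620522 §4; odd `L` from the datum)
  obtain ⟨c35₀, c₆, K₆, M₆, hc35₀, hc₆, hK₆, hM₆, hP6⟩ :=
    prop6At_binder_domainSeq_holds (𝔸 := θ.𝔸) hD hL5 θ.hL.1 (fun _ : ZdIdx θ.D θ.L => True)
  refine ⟨c35₀, M₆, hc35₀, hM₆, ?_⟩
  intro c35 hc35 M₃ hM₃ B₀'H B₂' BG BR cL hB₀'H hB₂' hBG hBR hcL SLet SLetUB I π geo Gp GA mem hmem ιLoc ops τ Cτ hCτ ops₀ hops a₃ c69 β cS cSβ CH len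
    h33 hdict hinv hcurv hlan hhol hlin hsrc hsrcH ha₃ hc69 hcS hcSβ γ₈ hγ₈ Pκ p5ePer
  refine exists_residB8_b8LeafOfRecordSubBP₂DPerκ_cutSubBP₅κ_of_letters_thm33_junctionH_withQQP_guarded θ hD hL5 Mκ Rκ hB₀'H hB₂' hBG hBR hcL SLet SLetUB
    geo (fun i => bgZd θ.𝔸 θ.L (π i)) Gp GA mem (fun M i m U₀ hU₀ => ιCfgZd θ.𝔸 θ.L M i m U₀ hU₀) ιLoc ops τ hCτ ops₀ hops h33 hdict ?_ hinv hcurv hlan hhol hlin hsrc hsrcH hc₆ hK₆ ha₃ hc69 hcS hcSβ hγ₈ Pκ p5ePer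
  -- `hP6` DISCHARGED: the member obeys (1.3)–(1.4) (`IdxB8SubD.domainSeq`), the floor `M₆ ≤ M₃ ≤ M`, the class constant moved up to the leaf's `c35`,
  -- and the (3.35) field transported from `memZd M j m` to `π (mem M j m)` along `hmem` (the field unfolded by `reg335_bgZd_iff`)
  intro M j m hM1 hM hm α₀ U₀ hU₀ hα₀ hMα hIn
  have h6 := prop6At_bgZd_mono (𝔸 := θ.𝔸) hL1 hc35 (le_trans zero_le_one hM1) hK₆.le
    (hP6 M j.1.1.1.1.1 m trivial j.1.domainSeq (le_trans hM₃ hM)) α₀ U₀ hU₀ hα₀ hMα hIn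
  rw [reg335_bgZd_iff] at h6
  show (bgZd θ.𝔸 θ.L (π (mem M j.1.1.1.1.1 m))).Reg335 c35 (K₆ * α₀) (ιCfgZd θ.𝔸 θ.L M j.1.1.1.1.1 m U₀ hU₀)
  rw [reg335_bgZd_iff, hmem M j m]
  exact h6

end WithQQPP6IGuarded

end Summit.QuantumFields.YangMills.BalabanUVNodes.N05SubBP2DK2PerKappaSlotExistsOfThm33JunctionHWithQQPP6Guarded

end
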